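import Summits.ResolutionOfSingularities.ResolutionOfSingularities.Theorems.HilbertSamuelEliminationSigmaMaxModificationsCorridor3ChartDictionary
import Literature.AlgebraicGeometry.Resolution.HypersurfacePushforward
import Mathlib.RingTheory.KrullDimension.Regular
import HarnessLib

/-!
# Route `HilbertSamuelElimination`, crux `SigmaMaxModificationsCorridor3`
# (stmt-ResolutionOfSingularities-19249; child of `SigmaMaxModifications` stmt-…-18506),
# line `tame_wild` v3 — brick T1, step 2: the chart dictionary FROM THE ORDER BOUND

[OURS · L1 W4.2] Second step of the per-chart transfer `stub_T1_chartTransfer` (hypothesis `hT1` of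
`confinedTameNu3_of_thor4_of_T123`, p483233). The landed brick T4 (`Helpers.stub_T4_chartDictionary`,
p482357) derives the dictionary `supp(Z, I, ∅, m) = ι(V(ν))`, `ord I ≤ m` from MAXIMALITY of `ν` in an
ambient `Y`; along the embedded tower of T1 no ambient `Y` is available upstairs, but the order bound
`ord ≤ m` PROPAGATES (CoP1 Prop. 4.2 (a), tree `IsBlowup.idealOrder_controlledTransform_le_of_forall`),
and the dictionary follows from it alone. Chart-intrinsic form: a closed immersion `ι : V → Z` into a
regular `Z` whose kernel ideal sheaf is a hypersurface (principal stalks) of order `≤ m` everywhere,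
`dim 𝒪_{V,v} ≤ 3` for all `v`. PROVED here:

* `exists_mult_of_chart` — every `v ∈ V` is a hypersurface point of some multiplicity
  `1 ≤ m' ≤ m`: `ord_{ι v} (ker ι) = m'` and `H³_V(v) = hypersurfaceHF m'` (Bennett at every level,
  p465246 `hsFun_eq_hypersurfaceHFe_of_stalk_ringEquiv`, through the stalk isomorphism
  `𝒪_{V,v} ≅ 𝒪_{Z,ι v}/(t)` of the closed immersion);
* `hsFun_le_hypersurfaceHF_of_chart` — all values of `Σ_V(3)` are `≤ hypersurfaceHF m`;
* `support_eq_image_hsStratum_of_forall_idealOrder_le` — **`supp(Z, ker ι, E, m) = ι(V(hypersurfaceHF m))`**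
  for every boundary `E`;
* `not_mem_hsValues_of_support_eq_empty` — empty support kills the value `hypersurfaceHF m` on `V`.

NOT a statement of any manuscript.

## Sources

* V. Cossart, U. Jannsen, S. Saito, LNM 2270 (2020), Thm. 2.3, Lemma 2.23, Def. 2.28. [CossartJannsenSaito2020]
* E. Bierstone, D. Grigoriev, P. Milman, J. Włodarczyk, arXiv:1206.3090, §3.1, Def. 3.1.2. [BierstoneGrigorievMilmanWlodarczyk2011]
* V. Cossart, O. Piltant, J. Algebra 320 (2008), proof of Prop. 4.2 (a). [CossartPiltant2008]
-/

set_option linter.dupNamespace false -- mandated namespace of this single-conjunct summit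

noncomputable section

open CategoryTheory AlgebraicGeometry TopologicalSpace Topology IsLocalRing
open Literature.AlgebraicGeometry.Resolution Literature.RingTheory.HilbertSamuel
open Summit.ResolutionOfSingularities.ResolutionOfSingularities.Theorems.SigmaMaxModificationsCorridor3.TameWild

namespace Summit.ResolutionOfSingularities.ResolutionOfSingularities.Theorems.SigmaMaxModificationsCorridor3.Helpers

section Chart

variable {V Z : Scheme.{0}} (ι : V ⟶ Z) [IsClosedImmersion ι]

/-- The support of the kernel ideal sheaf of a closed immersion is its range. [folklore] -/
theorem coe_support_ker_eq_range : (ι.ker.support : Set Z) = Set.range ι.base := by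
  rw [Scheme.Hom.support_ker, ι.isClosedEmbedding.isClosed_range.closure_eq]

/-- **Every point of a hypersurface chart is a hypersurface point of multiplicity `m' ≤ m`.** For a
closed immersion `ι : V → Z` into a regular `Z` whose kernel is a hypersurface (principal stalks) of
order `≤ m` everywhere and `dim 𝒪_{V,v} ≤ 3` for all `v`: at each `v ∈ V` the order
`m' = ord_{ι v}(ker ι)` is a natural number `1 ≤ m' ≤ m`, and `H³_V(v) = hypersurfaceHF m'`
(`𝒪_{V,v} ≅ 𝒪_{Z,ι v}/(t)`, `ord t = m'`, `dim 𝒪_{Z,ι v} = dim 𝒪_{V,v} + 1 ≤ 4`; Bennett at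
every level). [cite: CossartJannsenSaito2020, Thm. 2.3, Def. 2.28] -/
theorem exists_mult_of_chart (hZ : Scheme.IsRegular Z) (hI : ∀ z, (stalkIdeal ι.ker z).IsPrincipal)
    {m : ℕ} (hord : ∀ z, idealOrder ι.ker z ≤ (m : ℕ∞))
    (hdim : ∀ v : V, ringKrullDim (V.presheaf.stalk v) ≤ ((3 : ℕ) : WithBot ℕ∞)) (v : V) :
    ∃ m' : ℕ, 1 ≤ m' ∧ m' ≤ m ∧ idealOrder ι.ker (ι.base v) = m' ∧
      Scheme.hsFun V 3 v = hypersurfaceHF m' := by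
  haveI : IsRegularLocalRing (Z.presheaf.stalk (ι.base v)) := hZ _
  haveI : IsDomain (Z.presheaf.stalk (ι.base v)) := isDomain_of_isRegularLocalRing _
  obtain ⟨t, ht⟩ := (Submodule.isPrincipal_iff _).mp (hI (ι.base v))
  have hIt : stalkIdeal ι.ker (ι.base v) = Ideal.span {t} := ht
  have hle : ∀ i : ℕ, ((i : ℕ) : ℕ∞) ≤ idealOrder ι.ker (ι.base v) ↔
      t ∈ maximalIdeal (Z.presheaf.stalk (ι.base v)) ^ i := fun i => by
    rw [le_idealOrder_iff, hIt, Ideal.span_singleton_le_iff_mem]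
  -- `t ∈ 𝔪` since `ι v ∈ V(ker ι)`
  have htm : t ∈ maximalIdeal (Z.presheaf.stalk (ι.base v)) := by
    have h := (mem_support_iff_stalkIdeal_le ι.ker (ι.base v)).mp (apply_mem_support_ker ι v)
    rw [hIt, Ideal.span_singleton_le_iff_mem] at h
    exact h
  -- the order is a natural number `m' ≤ m`
  obtain ⟨m', hm'⟩ : ∃ m' : ℕ, idealOrder ι.ker (ι.base v) = m' :=
    ⟨(idealOrder ι.ker (ι.base v)).toNat,
      (ENat.coe_toNat (ne_top_of_le_ne_top (ENat.coe_ne_top m) (hord _))).symm⟩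
  have hm'm : m' ≤ m := by
    have h := hord (ι.base v)
    rw [hm'] at h
    exact_mod_cast h
  have hm'1 : 1 ≤ m' := by
    have h := (hle 1).mpr (by rw [pow_one]; exact htm)
    rw [hm'] at h
    exact_mod_cast h
  have hgm : t ∈ maximalIdeal (Z.presheaf.stalk (ι.base v)) ^ m' := (hle m').mp (by rw [hm'])
  have hgm' : t ∉ maximalIdeal (Z.presheaf.stalk (ι.base v)) ^ (m' + 1) := by
    intro h
    have h2 := (hle (m' + 1)).mpr h
    rw [hm'] at h2
    exact absurd (by exact_mod_cast h2 : m' + 1 ≤ m') (by omega)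
  have ht0 : t ≠ 0 := fun h => hgm' (h ▸ zero_mem _)
  -- the stalk isomorphism `𝒪_{V,v} ≃ 𝒪_{Z,ι v}/(t)`
  have hker : RingHom.ker (ι.stalkMap v).hom = Ideal.span {t} := by
    rw [← stalkIdeal_ker_eq_ker_stalkMap ι v, hIt]
  have hsurj : Function.Surjective (ι.stalkMap v).hom := ι.stalkMap_surjective v
  let εV : V.presheaf.stalk v ≃+* Z.presheaf.stalk (ι.base v) ⧸ Ideal.span {t} :=
    ((Ideal.quotEquivOfEq hker.symm).trans (RingHom.quotientKerEquivOfSurjective hsurj)).symm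
  -- `dim 𝒪_{Z,ι v} = dim 𝒪_{V,v} + 1 ≤ 4`
  obtain ⟨e, he⟩ : ∃ e : ℕ, ringKrullDim (Z.presheaf.stalk (ι.base v)) = e :=
    exists_nat_eq_of_ne_bot_of_ne_top ringKrullDim_ne_bot ringKrullDim_ne_top
  have he4 : e ≤ 3 + 1 := by
    have h1 := ringKrullDim_quotient_span_singleton_succ_eq_ringKrullDim_of_mem_nonZeroDivisors
      (mem_nonZeroDivisors_of_ne_zero ht0) htm
    have h2 : ringKrullDim (Z.presheaf.stalk (ι.base v) ⧸ Ideal.span {t}) ≤ ((3 : ℕ) : WithBot ℕ∞) := by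
      rw [← ringKrullDim_eq_of_ringEquiv εV]
      exact hdim v
    have h3 : (e : WithBot ℕ∞) ≤ ((3 : ℕ) : WithBot ℕ∞) + 1 := by
      rw [← he, ← h1]
      exact add_le_add h2 le_rfl
    exact_mod_cast h3
  refine ⟨m', hm'1, hm'm, hm', ?_⟩
  rw [← hypersurfaceHFe_four, show (4 : ℕ) = 3 + 1 from rfl]
  exact hsFun_eq_hypersurfaceHFe_of_stalk_ringEquiv he he4 hm'1 hgm hgm' εV

/-- **All values of `Σ_V(3)` are `≤ hypersurfaceHF m`** on a hypersurface chart of order `≤ m`.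
[cite: CossartJannsenSaito2020, Thm. 2.3] -/
theorem hsFun_le_hypersurfaceHF_of_chart (hZ : Scheme.IsRegular Z)
    (hI : ∀ z, (stalkIdeal ι.ker z).IsPrincipal) {m : ℕ} (hord : ∀ z, idealOrder ι.ker z ≤ (m : ℕ∞))
    (hdim : ∀ v : V, ringKrullDim (V.presheaf.stalk v) ≤ ((3 : ℕ) : WithBot ℕ∞)) (v : V) :
    Scheme.hsFun V 3 v ≤ hypersurfaceHF m := by
  obtain ⟨m', -, hm'm, -, hv⟩ := exists_mult_of_chart ι hZ hI hord hdim v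
  rw [hv, ← hypersurfaceHFe_four, ← hypersurfaceHFe_four]
  exact hypersurfaceHFe_mono_right 4 hm'm

/-- **The chart dictionary from the order bound: `supp(Z, ker ι, E, m) = ι(V(hypersurfaceHF m))`**
(any boundary `E`). A point of the support has order `≥ m ≥ 1`, so lies in `V(ker ι) = ι(V)`, with
order exactly `m`, i.e. multiplicity `m`, i.e. value `hypersurfaceHF m`; conversely a point of the
stratum has multiplicity `m` by injectivity of `m ↦ hypersurfaceHF m`.
[cite: BierstoneGrigorievMilmanWlodarczyk2011, Def. 3.1.2] [cite: CossartJannsenSaito2020, Thm. 2.3] -/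
theorem support_eq_image_hsStratum_of_forall_idealOrder_le (hZ : Scheme.IsRegular Z)
    (hI : ∀ z, (stalkIdeal ι.ker z).IsPrincipal) {m : ℕ} (hm : 1 ≤ m)
    (hord : ∀ z, idealOrder ι.ker z ≤ (m : ℕ∞))
    (hdim : ∀ v : V, ringKrullDim (V.presheaf.stalk v) ≤ ((3 : ℕ) : WithBot ℕ∞))
    (E : List Z.IdealSheafData) :
    (⟨ι.ker, E, m⟩ : MarkedIdeal Z).support = ι.base '' Scheme.hsStratum V 3 (hypersurfaceHF m) := by
  ext z
  constructor
  · intro hz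
    have hzm : ((m : ℕ) : ℕ∞) ≤ idealOrder ι.ker z := hz
    have hz1 : ((1 : ℕ) : ℕ∞) ≤ idealOrder ι.ker z := le_trans (by exact_mod_cast hm) hzm
    have hzs : z ∈ (ι.ker.support : Set Z) := by
      rw [SetLike.mem_coe, mem_support_iff_stalkIdeal_le, ← pow_one (maximalIdeal _)]
      exact (le_idealOrder_iff ι.ker z 1).mp hz1
    rw [coe_support_ker_eq_range] at hzs
    obtain ⟨v, rfl⟩ := hzs
    obtain ⟨m', -, hm'm, hm', hv⟩ := exists_mult_of_chart ι hZ hI hord hdim v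
    have hmm' : m' = m := by
      rw [hm'] at hzm
      exact le_antisymm hm'm (by exact_mod_cast hzm)
    exact ⟨v, by rw [Scheme.mem_hsStratum_iff, hv, hmm'], rfl⟩
  · rintro ⟨v, hv, rfl⟩
    obtain ⟨m', -, -, hm', hv'⟩ := exists_mult_of_chart ι hZ hI hord hdim v
    rw [Scheme.mem_hsStratum_iff, hv', ← hypersurfaceHFe_four, ← hypersurfaceHFe_four] at hv
    have hmm' : m' = m := hypersurfaceHFe_injective (by norm_num) hv
    show ((m : ℕ) : ℕ∞) ≤ idealOrder ι.ker (ι.base v)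
    rw [hm', hmm']

/-- **Empty support kills the value.** If `supp(Z, ker ι, E, m) = ∅` then `hypersurfaceHF m` is not
a value of `Σ_V(3)`. [cite: CossartJannsenSaito2020, Def. 6.14] -/
theorem not_mem_hsValues_of_support_eq_empty (hZ : Scheme.IsRegular Z)
    (hI : ∀ z, (stalkIdeal ι.ker z).IsPrincipal) {m : ℕ} (hm : 1 ≤ m)
    (hord : ∀ z, idealOrder ι.ker z ≤ (m : ℕ∞))
    (hdim : ∀ v : V, ringKrullDim (V.presheaf.stalk v) ≤ ((3 : ℕ) : WithBot ℕ∞))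
    {E : List Z.IdealSheafData} (hsupp : (⟨ι.ker, E, m⟩ : MarkedIdeal Z).support = ∅) :
    hypersurfaceHF m ∉ Scheme.hsValues V 3 := by
  rintro ⟨v, hv⟩
  have hmem : ι.base v ∈ (⟨ι.ker, E, m⟩ : MarkedIdeal Z).support := by
    rw [support_eq_image_hsStratum_of_forall_idealOrder_le ι hZ hI hm hord hdim E]
    exact ⟨v, hv, rfl⟩
  rw [hsupp] at hmem
  exact hmem

/-- The centre of an admissible blow-up lies in `ι(V(hypersurfaceHF m))`, hence its pull-back to
`V` has support inside the stratum `V(hypersurfaceHF m)`. [cite: BierstoneGrigorievMilmanWlodarczyk2011, Def. 3.1.3 (1)] -/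
theorem support_comap_subset_hsStratum (hZ : Scheme.IsRegular Z)
    (hI : ∀ z, (stalkIdeal ι.ker z).IsPrincipal) {m : ℕ} (hm : 1 ≤ m)
    (hord : ∀ z, idealOrder ι.ker z ≤ (m : ℕ∞))
    (hdim : ∀ v : V, ringKrullDim (V.presheaf.stalk v) ≤ ((3 : ℕ) : WithBot ℕ∞))
    {E : List Z.IdealSheafData} {C : Z.IdealSheafData}
    (hC : (C.support : Set Z) ⊆ (⟨ι.ker, E, m⟩ : MarkedIdeal Z).support) :
    ((C.comap ι).support : Set V) ⊆ Scheme.hsStratum V 3 (hypersurfaceHF m) := by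
  intro v hv
  rw [Scheme.IdealSheafData.support_comap] at hv
  have hz : ι.base v ∈ (⟨ι.ker, E, m⟩ : MarkedIdeal Z).support := hC hv
  rw [support_eq_image_hsStratum_of_forall_idealOrder_le ι hZ hI hm hord hdim E] at hz
  obtain ⟨v', hv', hvv'⟩ := hz
  rwa [← ι.isClosedEmbedding.injective hvv']

end Chart

end Summit.ResolutionOfSingularities.ResolutionOfSingularities.Theorems.SigmaMaxModificationsCorridor3.Helpers

end
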